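import Mathlib
import Literature.Analysis.FluidPDE.HardSphereCollisionRecord
import Literature.MathematicalPhysics.KineticTheory.HardSphereEuler
import Literature.MathematicalPhysics.KineticTheory.HardSphereEulerProofs
import Summits.AtomisticToContinuum.HydrodynamicLimit.Theorems.OneFlightGossipEngineOneFlightLayeredChaosFluxRegimes
import Summits.AtomisticToContinuum.HydrodynamicLimit.Theorems.OneFlightGossipEngineOneFlightLayeredChaosPairMeasurable
import Summits.AtomisticToContinuum.HydrodynamicLimit.Theorems.OneFlightGossipEngineOneFlightLayeredChaosFirstFlightInput
import HarnessLib

/-!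
# `OneFlightGossipEngine.OneFlightLayeredChaos` — the per-pair form of the first rung and its reduction
(crux stmt-AtomisticToContinuum-14535, line `Sketch`, serves the stub `stub_firstFlight_flux` — the `n = 0`, fresh-partner
rung — through the registered stub `regimeFluxBody_firstFlight_of_pairInput`; stub worker of lead cycle c3, 2026-08-16). Part of the Lean-checked reduction
`FirstFlightVelInput θ₀ → FirstFlightPairInput θ₀ → FirstFlightInput θ₀ → RegimeFluxBody θ₀ ((shortGap θ₀ 0).inter nZero)`
split over the files `…FirstCollision`, `…FluxFunctional`, `…PairMeasurable`, `…FirstFlightInput`,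
`…FirstFlightPairInput`, `…FirstFlightVelInput` (grouping namespace `OLC`).

`FirstFlightPairInput θ₀` (typed hypothesis): the same statement for a FIXED candidate partner `j ≠ i`, events of
`coarseConfig q z`, bound `Cσ^p/(N+1)`. `firstFlightInput_of_pairInput`: summing over the partner label (additivity of
measure and integral over the measurable, pairwise disjoint pieces `{nthPartnerOf i 0 = j}`; the flux integrand is
measurable on the good set and bounded by `1`) gives `FirstFlightInput θ₀`; `regimeFluxBody_firstFlight_of_pairInput`.
-/

open scoped BigOperators ENNReal
open MeasureTheory Set
open Literature.Analysis.FluidPDE Literature.MathematicalPhysics.KineticTheory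
open Summit.AtomisticToContinuum.HydrodynamicLimit.Theorems

namespace Summit.AtomisticToContinuum.HydrodynamicLimit.Theorems.OLC

noncomputable section

/-! ## The per-pair input and its reduction to `FirstFlightInput` -/

/-- **First-flight PAIR input (the typed dynamical input of the first rung).** For `N ≥ N₀(σ, τ)`, every flow `Φ`,
tagged particle `i`, candidate partner `j ≠ i`, measurable `S ⊆ ℝ³ × ℝ³` and measurable
`T ⊆ (cells × velocities)^{N+1}`: with `t₀ z` the first collision time of `i` after `0` and
`F = Φ.good ∩ {t₀ ∈ (0, w] ∧ nthPartnerOf i 0 = j ∧ j has no collision in (0, t₀)}` (the first collision of `i`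
happens inside the kinetic window, WITH `j`, and `j` is FRESH: both free paths from time `0` reach the contact
unobstructed by the other `N − 1` spheres), `ĝ z = (v_i − v_j)/‖v_i − v_j‖` and
`ω z = ε⁻¹ sepVec (freeFlight t₀ z i).1 (freeFlight t₀ z j).1` (the contact normal of the two FREE flights at `t₀`,
read off the time-`0` datum), `D = {coarseConfig q z ∈ T}` (an event of the `ℓ`-cells and exact velocities of all
particles at time `0`):
`|P(F ∩ {(ĝ, ω) ∈ S} ∩ D) − ∫_{F ∩ D} Flux_{ĝ z}(S_{ĝ z}) dP| ≤ C σ^p / (N + 1)`,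
`P` the global Gibbs law at activity `1`, temperature `θ₀`, mesh `ρ⋆(σ)`; `Flux_g(U) = ∫_U (−⟪ω,g⟫)₊ dω / ∫ (−⟪ω,g⟫)₊ dω`.
("Conditional Stosszahlansatz for a fixed pair, given coarse positions and exact velocities of everybody at time 0,
`N`-uniform at fixed reduced density"; the factor `(N+1)⁻¹` is the exchangeable share of one candidate partner.) A typed HYPOTHESIS of the line (a named
`Prop` the route posits; nothing is asserted, it is not a published fact); reduction:
`regimeFluxBody_firstFlight_of_pairInput`. -/
def FirstFlightPairInput (θ₀ : ℝ) : Prop :=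
  ∃ C : ℝ, 0 < C ∧ ∃ p : ℝ, 0 < p ∧ ∃ σ₀ : ℝ, 0 < σ₀ ∧ ∀ σ : ℝ, 0 < σ → σ < σ₀ →
  ∀ τ : ℝ, 0 < τ → ∃ N₀ : ℕ, ∀ N : ℕ, N₀ ≤ N →
    ∀ Φ : HardSphereFlow (Torus.geometry (Fin 3)) (hsDiameter σ N) (N + 1),
    ∀ (i j : Fin (N + 1)), j ≠ i → ∀ S : Set (V3 × V3), MeasurableSet S →
    ∀ T : Set (Fin (N + 1) → (Fin 3 → ℤ) × V3), MeasurableSet T →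
    let G : Geometry (Fin 3) T3 := Torus.geometry (Fin 3)
    let ε : ℝ := hsDiameter σ N
    let w : ℝ := τ * ((N + 1 : ℕ) : ℝ) ^ (-(1 / 3 : ℝ))
    let q : T3 → (Fin 3 → ℤ) := Torus.coarseCell (rhoStar σ * ((N + 1 : ℕ) : ℝ) ^ (-(1 / 3 : ℝ)))
    let P : Measure (Config (N + 1) (Fin 3) T3) := localGibbsLaw σ (fun _ => 1) (fun _ => 0) (fun _ => θ₀) N Φ
    let t₀ : Config (N + 1) (Fin 3) T3 → ℝ := fun z => Φ.nthCollisionTimeOf i 0 z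
    let F : Set (Config (N + 1) (Fin 3) T3) := Φ.good ∩ {z | t₀ z ∈ Set.Ioc 0 w ∧ Φ.nthPartnerOf i 0 z = j ∧
        ∀ u ∈ Set.Ioo 0 (t₀ z), ¬ Participates G ε (Φ.flow u z) j}
    let gPair : Config (N + 1) (Fin 3) T3 → V3 := fun z => ‖(z i).2 - (z j).2‖⁻¹ • ((z i).2 - (z j).2)
    let ωPair : Config (N + 1) (Fin 3) T3 → V3 := fun z =>
      ε⁻¹ • G.sepVec (freeFlight G (t₀ z) z i).1 (freeFlight G (t₀ z) z j).1
    let flux : V3 → Set V3 → ℝ := fun g U =>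
      ((∫⁻ ω, U.indicator (fun _ => (1 : ℝ≥0∞)) (ω : V3) * ENNReal.ofReal (max (-inner ℝ (ω : V3) g) 0)
          ∂(sphereMeasure (E := V3))) /
        (∫⁻ ω, ENNReal.ofReal (max (-inner ℝ (ω : V3) g) 0) ∂(sphereMeasure (E := V3)))).toReal
    let D : Set (Config (N + 1) (Fin 3) T3) := {z | coarseConfig q z ∈ T}
    |(P (F ∩ {z | (gPair z, ωPair z) ∈ S} ∩ D)).toReal -
        ∫ z in F ∩ D, flux (gPair z) {ω | (gPair z, ω) ∈ S} ∂P| ≤ C * σ ^ p / (N + 1)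

/-- **The per-pair input implies the time-zero entrance form** (`FirstFlightPairInput θ₀ → FirstFlightInput θ₀`):
slice the joint event `T ⊆ (cells × velocities)^{N+1} × Fin (N+1)` along the partner label, `T_j = {c | (c, j) ∈ T}`;
the first-flight event, the event `{(ĝ₀, ω₀) ∈ S}` and `D` split along the (measurable, pairwise disjoint) events
`{nthPartnerOf i 0 = j}`, `j : Fin (N + 1)`, into the per-pair pieces (on `{nthPartnerOf i 0 = j}` the random-partner
quantities ARE the pair quantities); measure and integral are additive over the pieces (the flux integrand is
measurable on the good set and bounded by `1`, hence integrable for the probability measure `P`, `σ ≤ 1/2`); the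
piece `j = i` is empty (`nthPartnerOf_zero_ne_self`); and `(N + 1) · Cσ^p/(N+1) = Cσ^p`. [folklore] -/
theorem firstFlightInput_of_pairInput {θ₀ : ℝ} (hθ : 0 < θ₀) (h : FirstFlightPairInput θ₀) :
    FirstFlightInput θ₀ := by
  obtain ⟨C, hC, p, hp, σ₀, hσ₀, H⟩ := h
  refine ⟨C, hC, p, hp, min σ₀ 2⁻¹, lt_min hσ₀ (by norm_num), fun σ hσ hσlt => ?_⟩
  have hσ₀' : σ < σ₀ := hσlt.trans_le (min_le_left _ _)
  have hσ2 : σ ≤ 1 / 2 := by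
    have := hσlt.trans_le (min_le_right _ _)
    rw [one_div]; exact this.le
  intro τ hτ
  obtain ⟨N₀, hN₀⟩ := H σ hσ hσ₀' τ hτ
  refine ⟨N₀, fun N hN Φ i S hS T hT => ?_⟩
  intro G ε w q P t₀ j F gZero ωZero flux D
  haveI : IsProbabilityMeasure P :=
    isProbabilityMeasure_localGibbsLaw continuous_const continuous_const continuous_const
      (fun _ => one_pos) (fun _ => hθ) hσ2 N Φ
  -- slices of `T` along the partner label and the per-pair pieces
  set Tj : Fin (N + 1) → Set (Fin (N + 1) → (Fin 3 → ℤ) × V3) := fun j₀ => {c | (c, j₀) ∈ T} with hTjdef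
  have hTj : ∀ j₀, MeasurableSet (Tj j₀) := fun j₀ => (measurable_id.prodMk measurable_const) hT
  set Fj : Fin (N + 1) → Set (Config (N + 1) (Fin 3) T3) := fun j₀ =>
    Φ.good ∩ {z | t₀ z ∈ Set.Ioc 0 w ∧ Φ.nthPartnerOf i 0 z = j₀ ∧
      ∀ u ∈ Set.Ioo 0 (t₀ z), ¬ Participates G ε (Φ.flow u z) j₀} with hFjdef
  set gP : Fin (N + 1) → Config (N + 1) (Fin 3) T3 → V3 := fun j₀ z =>
    ‖(z i).2 - (z j₀).2‖⁻¹ • ((z i).2 - (z j₀).2) with hgPdef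
  set ωP : Fin (N + 1) → Config (N + 1) (Fin 3) T3 → V3 := fun j₀ z =>
    ε⁻¹ • G.sepVec (freeFlight G (t₀ z) z i).1 (freeFlight G (t₀ z) z j₀).1 with hωPdef
  set Aj : Fin (N + 1) → Set (Config (N + 1) (Fin 3) T3) := fun j₀ => {z | (gP j₀ z, ωP j₀ z) ∈ S} with hAjdef
  set Dj : Fin (N + 1) → Set (Config (N + 1) (Fin 3) T3) := fun j₀ => {z | coarseConfig q z ∈ Tj j₀} with hDjdef
  -- (1) the per-pair bounds
  have hbound : ∀ j₀, |(P (Fj j₀ ∩ Aj j₀ ∩ Dj j₀)).toReal -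
      ∫ z in Fj j₀ ∩ Dj j₀, flux (gP j₀ z) {ω | (gP j₀ z, ω) ∈ S} ∂P| ≤ C * σ ^ p / (N + 1) := by
    intro j₀
    by_cases hj₀ : j₀ = i
    · -- the piece `j = i` is empty: the first partner of `i` is never `i`
      have hempty : Fj j₀ = ∅ := by
        refine eq_empty_of_forall_notMem fun z hz => ?_
        exact nthPartnerOf_zero_ne_self Φ i hz.1 hz.2.1.1 (hz.2.2.1.trans hj₀)
      simp only [hempty, Set.empty_inter, measure_empty, ENNReal.toReal_zero, Measure.restrict_empty,
        integral_zero_measure, sub_zero, abs_zero]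
      positivity
    · have hb := hN₀ N hN Φ i j₀ hj₀ S hS (Tj j₀) (hTj j₀)
      exact hb
  -- (2) on `{nthPartnerOf i 0 = j₀}` the random-partner quantities are the pair quantities
  have hgZ_eq : ∀ j₀ z, Φ.nthPartnerOf i 0 z = j₀ → gZero z = gP j₀ z := by
    intro j₀ z hj; subst hj; rfl
  have hωZ_eq : ∀ j₀ z, Φ.nthPartnerOf i 0 z = j₀ → ωZero z = ωP j₀ z := by
    intro j₀ z hj; subst hj; rfl
  -- (3) decomposition of the events along the partner label (memberships are converted through explicit
  -- `show`s: the kernel must never compare two different set-builder expressions under a binder)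
  have hFAD : F ∩ {z | (gZero z, ωZero z) ∈ S} ∩ D = ⋃ j₀, (Fj j₀ ∩ Aj j₀ ∩ Dj j₀) := by
    apply Subset.antisymm
    · rintro z ⟨⟨⟨hg, ht, hfr⟩, hA⟩, hD⟩
      have hA' : (gZero z, ωZero z) ∈ S := hA
      have hD' : (coarseConfig q z, j z) ∈ T := hD
      refine mem_iUnion.2 ⟨Φ.nthPartnerOf i 0 z, ⟨⟨hg, ht, rfl, hfr⟩, ?_⟩, ?_⟩
      · show (gP (Φ.nthPartnerOf i 0 z) z, ωP (Φ.nthPartnerOf i 0 z) z) ∈ S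
        rw [← hgZ_eq _ z rfl, ← hωZ_eq _ z rfl]
        exact hA'
      · show coarseConfig q z ∈ Tj (Φ.nthPartnerOf i 0 z)
        exact hD'
    · intro z hz
      obtain ⟨j₀, ⟨⟨hg, ht, hj, hfr⟩, hA⟩, hD⟩ := mem_iUnion.1 hz
      have hA' : (gP j₀ z, ωP j₀ z) ∈ S := hA
      have hD' : (coarseConfig q z, j₀) ∈ T := hD
      refine ⟨⟨⟨hg, ht, ?_⟩, ?_⟩, ?_⟩
      · intro u hu
        rw [show j z = j₀ from hj]
        exact hfr u hu
      · show (gZero z, ωZero z) ∈ S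
        rw [hgZ_eq j₀ z hj, hωZ_eq j₀ z hj]
        exact hA'
      · show (coarseConfig q z, j z) ∈ T
        rw [show j z = j₀ from hj]
        exact hD'
  have hFD : F ∩ D = ⋃ j₀, (Fj j₀ ∩ Dj j₀) := by
    apply Subset.antisymm
    · rintro z ⟨⟨hg, ht, hfr⟩, hD⟩
      have hD' : (coarseConfig q z, j z) ∈ T := hD
      refine mem_iUnion.2 ⟨Φ.nthPartnerOf i 0 z, ⟨hg, ht, rfl, hfr⟩, ?_⟩
      show coarseConfig q z ∈ Tj (Φ.nthPartnerOf i 0 z)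
      exact hD'
    · intro z hz
      obtain ⟨j₀, ⟨hg, ht, hj, hfr⟩, hD⟩ := mem_iUnion.1 hz
      have hD' : (coarseConfig q z, j₀) ∈ T := hD
      refine ⟨⟨hg, ht, ?_⟩, ?_⟩
      · intro u hu
        rw [show j z = j₀ from hj]
        exact hfr u hu
      · show (coarseConfig q z, j z) ∈ T
        rw [show j z = j₀ from hj]
        exact hD'
  -- (4) disjointness
  have hdisj1 : Pairwise (Function.onFun Disjoint fun j₀ => Fj j₀ ∩ Aj j₀ ∩ Dj j₀) := by
    intro a b hab
    rw [Function.onFun, Set.disjoint_left]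
    rintro z ⟨⟨hza, -⟩, -⟩ ⟨⟨hzb, -⟩, -⟩
    exact hab (hza.2.2.1.symm.trans hzb.2.2.1)
  have hdisj2 : Pairwise (Function.onFun Disjoint fun j₀ => Fj j₀ ∩ Dj j₀) := by
    intro a b hab
    rw [Function.onFun, Set.disjoint_left]
    rintro z ⟨hza, -⟩ ⟨hzb, -⟩
    exact hab (hza.2.2.1.symm.trans hzb.2.2.1)
  -- (5) measurability of the pieces
  have hFmeas : MeasurableSet F := measurableSet_firstFlightEvent Φ i w
  have hpartm : ∀ j₀, MeasurableSet (Φ.good ∩ {z | Φ.nthPartnerOf i 0 z = j₀}) := fun j₀ =>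
    measurableSet_inter_setOf_of_restrict Φ.measurableSet_good
      ((measurable_nthPartnerOf_restrict Φ i 0) (measurableSet_singleton j₀))
  have hFj_eq : ∀ j₀, Fj j₀ = F ∩ (Φ.good ∩ {z | Φ.nthPartnerOf i 0 z = j₀}) := by
    intro j₀
    ext z
    constructor
    · rintro ⟨hg, ht, hj, hfr⟩
      subst hj
      exact ⟨⟨hg, ht, hfr⟩, hg, rfl⟩
    · rintro ⟨⟨hg, ht, hfr⟩, -, hj⟩
      subst hj
      exact ⟨hg, ht, rfl, hfr⟩
  have hFjm : ∀ j₀, MeasurableSet (Fj j₀) := fun j₀ => by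
    rw [hFj_eq]
    exact hFmeas.inter (hpartm j₀)
  -- measurability of the pair quantities (`ĝ` globally, `ω` on the good set through `t₀`)
  have hvk : ∀ k, Measurable fun z : Config (N + 1) (Fin 3) T3 => (z k).2 := fun k =>
    measurable_snd.comp (measurable_pi_apply k)
  have hgPm : ∀ j₀, Measurable (gP j₀) := fun j₀ =>
    (((hvk i).sub (hvk j₀)).norm.inv).smul ((hvk i).sub (hvk j₀))
  have ht₀m : Measurable fun z : Φ.good => Φ.nthCollisionTimeOf i 0 (z : Config (N + 1) (Fin 3) T3) :=
    measurable_nthCollisionTimeOf_restrict Φ i 0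
  have hposk : ∀ k, Measurable fun z : Φ.good => ((z : Config (N + 1) (Fin 3) T3) k).1 := fun k =>
    measurable_fst.comp ((measurable_pi_apply k).comp measurable_subtype_coe)
  have hvelk : ∀ k, Measurable fun z : Φ.good => ((z : Config (N + 1) (Fin 3) T3) k).2 := fun k =>
    measurable_snd.comp ((measurable_pi_apply k).comp measurable_subtype_coe)
  have hffk : ∀ k, Measurable fun z : Φ.good =>
      (freeFlight G (t₀ (z : Config (N + 1) (Fin 3) T3)) (z : Config (N + 1) (Fin 3) T3) k).1 := by
    intro k
    show Measurable fun z : Φ.good => ((z : Config (N + 1) (Fin 3) T3) k).1 +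
      Literature.Analysis.FunctionSpaces.Torus.proj
        (Φ.nthCollisionTimeOf i 0 (z : Config (N + 1) (Fin 3) T3) • ((z : Config (N + 1) (Fin 3) T3) k).2)
    exact (hposk k).add
      (Literature.Analysis.FunctionSpaces.Torus.continuous_proj.measurable.comp (ht₀m.smul (hvelk k)))
  have hωPm : ∀ j₀, Measurable fun z : Φ.good => ωP j₀ (z : Config (N + 1) (Fin 3) T3) := fun j₀ =>
    (measurable_const_smul ε⁻¹).comp (Torus.measurable_geometry_sepVec.comp ((hffk i).prodMk (hffk j₀)))
  have hAjm : ∀ j₀, MeasurableSet (Φ.good ∩ Aj j₀) := fun j₀ =>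
    measurableSet_inter_setOf_of_restrict Φ.measurableSet_good
      ((((hgPm j₀).comp measurable_subtype_coe).prodMk (hωPm j₀)) hS)
  have hDjm : ∀ j₀, MeasurableSet (Dj j₀) := fun j₀ =>
    (measurable_coarseConfig (Torus.measurable_coarseCell _)) (hTj j₀)
  have hpiece1 : ∀ j₀, MeasurableSet (Fj j₀ ∩ Aj j₀ ∩ Dj j₀) := by
    intro j₀
    have : Fj j₀ ∩ Aj j₀ ∩ Dj j₀ = Fj j₀ ∩ (Φ.good ∩ Aj j₀) ∩ Dj j₀ := by
      ext z
      simp only [mem_inter_iff]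
      constructor
      · rintro ⟨⟨hF, hA⟩, hD⟩; exact ⟨⟨hF, hF.1, hA⟩, hD⟩
      · rintro ⟨⟨hF, -, hA⟩, hD⟩; exact ⟨⟨hF, hA⟩, hD⟩
    rw [this]
    exact ((hFjm j₀).inter (hAjm j₀)).inter (hDjm j₀)
  have hpiece2 : ∀ j₀, MeasurableSet (Fj j₀ ∩ Dj j₀) := fun j₀ => (hFjm j₀).inter (hDjm j₀)
  -- (6) integrability of the flux integrand (measurable on the good set, bounded by `1`)
  have heval : Measurable fun pr : (Fin (N + 1) → T3 × V3) × Fin (N + 1) => (pr.1 pr.2).2 :=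
    measurable_from_prod_countable_left fun k => measurable_snd.comp (measurable_pi_apply k)
  have hvj : Measurable fun z : Φ.good =>
      ((z : Config (N + 1) (Fin 3) T3) (Φ.nthPartnerOf i 0 (z : Config (N + 1) (Fin 3) T3))).2 :=
    heval.comp (measurable_subtype_coe.prodMk (measurable_nthPartnerOf_restrict Φ i 0))
  have hgZm : Measurable fun z : Φ.good => gZero (z : Config (N + 1) (Fin 3) T3) := by
    show Measurable fun z : Φ.good =>
      ‖((z : Config (N + 1) (Fin 3) T3) i).2 -
          ((z : Config (N + 1) (Fin 3) T3) (Φ.nthPartnerOf i 0 (z : Config (N + 1) (Fin 3) T3))).2‖⁻¹ •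
        (((z : Config (N + 1) (Fin 3) T3) i).2 -
          ((z : Config (N + 1) (Fin 3) T3) (Φ.nthPartnerOf i 0 (z : Config (N + 1) (Fin 3) T3))).2)
    exact (((hvelk i).sub hvj).norm.inv).smul ((hvelk i).sub hvj)
  have hfm : Measurable fun z : Φ.good =>
      flux (gZero (z : Config (N + 1) (Fin 3) T3)) {ω | (gZero (z : Config (N + 1) (Fin 3) T3), ω) ∈ S} :=
    (measurable_fluxFn hS).comp hgZm
  have hnull : P Φ.goodᶜ = 0 := localGibbsLaw_one_compl_good σ θ₀ N Φ
  have hPgood : P.restrict Φ.good = P := Measure.restrict_eq_self_of_ae_mem (mem_ae_iff.2 hnull)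
  have hfae : AEStronglyMeasurable (fun z => flux (gZero z) {ω | (gZero z, ω) ∈ S}) P := by
    have h1 : AEMeasurable (fun z => flux (gZero z) {ω | (gZero z, ω) ∈ S}) (P.restrict Φ.good) :=
      aemeasurable_restrict_of_measurable_subtype Φ.measurableSet_good hfm
    rw [hPgood] at h1
    exact h1.aestronglyMeasurable
  have hfbd : ∀ z, ‖flux (gZero z) {ω | (gZero z, ω) ∈ S}‖ ≤ 1 := by
    intro z
    have hz := fluxFn_mem_Icc (gZero z) {ω | (gZero z, ω) ∈ S}
    rw [Real.norm_eq_abs, abs_of_nonneg hz.1]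
    exact hz.2
  have hint : Integrable (fun z => flux (gZero z) {ω | (gZero z, ω) ∈ S}) P :=
    Integrable.of_bound hfae 1 (ae_of_all _ hfbd)
  -- (7) additivity of the two terms over the partner label
  have hPsum : (P (F ∩ {z | (gZero z, ωZero z) ∈ S} ∩ D)).toReal = ∑ j₀, (P (Fj j₀ ∩ Aj j₀ ∩ Dj j₀)).toReal := by
    rw [hFAD, measure_iUnion hdisj1 hpiece1, tsum_fintype, ENNReal.toReal_sum (fun j₀ _ => measure_ne_top _ _)]
  have hIsum : ∫ z in F ∩ D, flux (gZero z) {ω | (gZero z, ω) ∈ S} ∂P =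
      ∑ j₀, ∫ z in Fj j₀ ∩ Dj j₀, flux (gP j₀ z) {ω | (gP j₀ z, ω) ∈ S} ∂P := by
    rw [hFD, integral_iUnion_fintype hpiece2 hdisj2 (fun j₀ => hint.integrableOn)]
    refine Finset.sum_congr rfl fun j₀ _ => ?_
    refine setIntegral_congr_fun (hpiece2 j₀) fun z hz => ?_
    rw [hgZ_eq j₀ z hz.1.2.2.1]
  -- (8) sum the per-pair bounds
  rw [hPsum, hIsum, ← Finset.sum_sub_distrib]
  calc |∑ j₀, ((P (Fj j₀ ∩ Aj j₀ ∩ Dj j₀)).toReal -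
          ∫ z in Fj j₀ ∩ Dj j₀, flux (gP j₀ z) {ω | (gP j₀ z, ω) ∈ S} ∂P)|
      ≤ ∑ j₀, |(P (Fj j₀ ∩ Aj j₀ ∩ Dj j₀)).toReal -
          ∫ z in Fj j₀ ∩ Dj j₀, flux (gP j₀ z) {ω | (gP j₀ z, ω) ∈ S} ∂P| := Finset.abs_sum_le_sum_abs _ _
    _ ≤ ∑ _j₀ : Fin (N + 1), C * σ ^ p / (N + 1) := Finset.sum_le_sum fun j₀ _ => hbound j₀
    _ = C * σ ^ p := by
      rw [Finset.sum_const, Finset.card_univ, Fintype.card_fin, nsmul_eq_mul]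
      have hN1 : ((N + 1 : ℕ) : ℝ) ≠ 0 := by positivity
      field_simp
      push_cast
      ring

/-- **The reduction of the first rung to the per-pair input**: `FirstFlightPairInput θ₀` implies the flux-form body
of the crux on the regime `{s_i = s_j} ∩ {n = 0}` (the lead's `(shortGap θ₀ 0).inter nZero`). [folklore] -/
theorem regimeFluxBody_firstFlight_of_pairInput : ∀ {θ₀ : ℝ}, 0 < θ₀ → Summit.AtomisticToContinuum.HydrodynamicLimit.Theorems.OLC.FirstFlightPairInput θ₀ → Summit.AtomisticToContinuum.HydrodynamicLimit.Theorems.OLC.RegimeFluxBody θ₀ ((Summit.AtomisticToContinuum.HydrodynamicLimit.Theorems.OLC.shortGap θ₀ 0).inter (fun _ n _ _ _ => {_z | n = 0})) := by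
  intro θ₀ hθ h
  exact regimeFluxBody_firstFlight_of_input (firstFlightInput_of_pairInput hθ h)

end

end Summit.AtomisticToContinuum.HydrodynamicLimit.Theorems.OLC
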